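import Summits.CriticalPhenomena.CardyFormulaZ2.Theses.CardyQContinuation
import Literature.Probability.LatticeModels.FKIsingQuadrilateralCrossing
import Summits.CriticalPhenomena.CardyFormulaZ2.Theorems.CardyQContinuationIsingJetsConformalStubCrossingFunctionProps
import Literature.Probability.RandomPlanarGeometry.CrossRatioContinuity
import Literature.Probability.RandomPlanarGeometry.ConformalRectangleProofs
import Literature.Analysis.Potential.HarmonicMeasure

/-!
# Crux `IsingJetsConformal`, stub `stub_loopSymmetricLimit_csLimitAlongSequence`:
# the Chelkak–Smirnov crossing probabilities converge along a Radó-convergent sequence of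
# designed discrete quadrilaterals (route `CardyQContinuation`, item stmt-CriticalPhenomena-5560,
# `n = 0` bridge)

In the `n = 0` bridge of the crux the Chelkak–Smirnov crossing theorem
(`Literature.Probability.LatticeModels.ChelkakSmirnov2012_fkIsingQuadrilateralCrossing`, a named
fact taken here as a HYPOTHESIS) is applied to designed square-lattice discrete quadrilaterals
`E k` at meshes `δ k → 0⁺` whose polygonal domains `Ω_k = DiscreteRect.csDomain (E k) (d₀ k) (nn k) (δ k)`,
viewed as conformal rectangles `Q k` (carrier `Ω_k`, corners the lattice points
`meshPoint (δ k) (csCorner … j)`, Jordan arcs `0, 2` inside the black arcs), converge in Radó's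
sense (uniform convergence of the boundary loops and of the marked points) to a limit rectangle
`R`, with a common interior disc `B(z₀, r) ⊆ Ω_k ⊆ B(z₀, Rad)` and all four arcs of harmonic
measure `≥ t` seen from `z₀` (eventually in `k`). Conclusion: the CS crossing probabilities
`P_k = DiscreteRect.csCrossingProb (E k) (d₀ k) (nn k)` converge to `p(η(R))`,
`p = fkIsingCrossingFunction`, `η(R) = crossRatio x` for any uniformizing datum `(φ, x)` of `R`.

Proof. The fact with parameters `(r, Rad, t)` gives `ε` with `ε → 0` along `𝓝[>] 0`; since
`δ k > 0` and `δ k → 0`, `ε (δ k) → 0`. For each `k` choose a uniformizing datum `(ψ k, y k)` of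
`Q k` (`MarkedDomain.exists_isUniformizing_holds`); transporting `ψ k : ℍ → (Q k).carrier` along
the carrier equality `Ω_k = (Q k).carrier` (by `subst` in the helper
`CsLimitAlongSequence.abs_sub_le_of_carrier_eq`) and bounding the harmonic measures of the black
arcs from below by those of the Jordan arcs `0, 2` (`harmonicMeasure_mono`), the fact yields
eventually `|P_k - p(crossRatio (y k))| ≤ ε (δ k)`. By the continuity of the conformal modulus
under Radó convergence (`ConformalRectangle.tendsto_crossRatio_of_tendstoUniformly`),
`crossRatio (y k) → crossRatio x`, and `p` is continuous
(`FkIsingCrossingFunctionProps.fkIsingCrossingFunction_continuous`),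
so `p(crossRatio (y k)) → p(crossRatio x)`; a squeeze (`Filter.Tendsto.congr_dist`) concludes.

References: D. Chelkak, S. Smirnov, *Universality in the 2D Ising model and conformal invariance
of fermionic observables*, Invent. Math. 189 (2012), Thm. 6.1; Ch. Pommerenke, *Boundary
Behaviour of Conformal Maps* (1992), §2.3 Thm. 2.11 (Radó).
-/

namespace Summit.CriticalPhenomena.CardyFormulaZ2.Theorems.CardyQContinuation

open Set Metric Filter
open scoped Topology
open Literature.Analysis.Potential (harmonicMeasure harmonicMeasure_mono)
open Literature.Probability.RandomPlanarGeometry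
open Literature.Probability.LatticeModels

noncomputable section

namespace CsLimitAlongSequence

/-- **One application of the Chelkak–Smirnov bound, with the conformal map living on a carrier
`U` that is only propositionally equal to the polygonal domain.** If `ε` satisfies the conclusion
of `ChelkakSmirnov2012_fkIsingQuadrilateralCrossing` for the parameters `(r, Rad, t)`, and a
discrete quadrilateral at mesh `δ > 0` has `csDomain = U` with `B(z₀, r) ⊆ U ⊆ B(z₀, Rad)`, both
black arcs of harmonic measure `≥ t` in `U` seen from `z₀`, and `ψ : ℍ → U` is conformal with the
four corners as boundary values at monotone real points `y`, then
`|P^δ - p(crossRatio y)| ≤ ε δ`. (The carrier equality is eliminated by `subst`.) [folklore] -/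
theorem abs_sub_le_of_carrier_eq {r Rad t : ℝ} {ε : ℝ → ℝ}
    (hε : ∀ (δ : ℝ) (E : Finset (Sym2 (Site 2))) (d₀ : Site 2 × Fin 4) (n : Fin 4 → ℕ) (z₀ : ℂ),
      0 < δ → DiscreteRect.IsCSQuadrilateral E d₀ n →
      let U : Set ℂ := DiscreteRect.csDomain E d₀ n δ
      Metric.ball z₀ r ⊆ U → U ⊆ Metric.ball z₀ Rad →
      (t ≤ harmonicMeasure U z₀ (DiscreteRect.blackArc E d₀ n δ 0) ∧
          t ≤ harmonicMeasure U z₀ (DiscreteRect.blackArc E d₀ n δ 2) ∨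
        t ≤ harmonicMeasure U z₀ (DiscreteRect.whiteArc E d₀ n δ 1) ∧
          t ≤ harmonicMeasure U z₀ (DiscreteRect.whiteArc E d₀ n δ 3)) →
      ∀ (φ : ConformalEquiv UpperHalfPlane.upperHalfPlaneSet U) (x : Fin 4 → ℝ),
        (StrictMono x ∨ StrictAnti x) →
        (∀ j : Fin 4, φ.HasBoundaryValue (x j) (meshPoint δ (DiscreteRect.csCorner E d₀ n j))) →
        |DiscreteRect.csCrossingProb E d₀ n - fkIsingCrossingFunction (crossRatio x)| ≤ ε δ)
    {δ : ℝ} {E : Finset (Sym2 (Site 2))} {d₀ : Site 2 × Fin 4} {n : Fin 4 → ℕ} {z₀ : ℂ}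
    (hδ : 0 < δ) (hq : DiscreteRect.IsCSQuadrilateral E d₀ n) {U : Set ℂ}
    (hU : DiscreteRect.csDomain E d₀ n δ = U) (hball : Metric.ball z₀ r ⊆ U)
    (hsub : U ⊆ Metric.ball z₀ Rad)
    (h0 : t ≤ harmonicMeasure U z₀ (DiscreteRect.blackArc E d₀ n δ 0))
    (h2 : t ≤ harmonicMeasure U z₀ (DiscreteRect.blackArc E d₀ n δ 2))
    (ψ : ConformalEquiv UpperHalfPlane.upperHalfPlaneSet U) (y : Fin 4 → ℝ)
    (hmono : StrictMono y ∨ StrictAnti y)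
    (hbv : ∀ j : Fin 4, ψ.HasBoundaryValue (y j) (meshPoint δ (DiscreteRect.csCorner E d₀ n j))) :
    |DiscreteRect.csCrossingProb E d₀ n - fkIsingCrossingFunction (crossRatio y)| ≤ ε δ := by
  subst hU
  exact hε δ E d₀ n z₀ hδ hq hball hsub (Or.inl ⟨h0, h2⟩) ψ y hmono hbv

/-- A sequence of positive reals tending to `0` tends to `0` within `(0, ∞)`. [folklore] -/
theorem tendsto_nhdsWithin_Ioi_of_pos {δ : ℕ → ℝ} (hpos : ∀ k, 0 < δ k)
    (hδ : Tendsto δ atTop (𝓝 0)) : Tendsto δ atTop (𝓝[>] 0) :=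
  tendsto_nhdsWithin_iff.2 ⟨hδ, Eventually.of_forall hpos⟩

/-- **Squeeze**: if `|f k - g k| ≤ e k` eventually, `e k → 0` and `g k → a`, then `f k → a`.
[folklore] -/
theorem tendsto_of_abs_sub_le {f g e : ℕ → ℝ} {a : ℝ} (hg : Tendsto g atTop (𝓝 a))
    (he : Tendsto e atTop (𝓝 0)) (hfg : ∀ᶠ k in atTop, |f k - g k| ≤ e k) :
    Tendsto f atTop (𝓝 a) := by
  refine hg.congr_dist (squeeze_zero' (Eventually.of_forall fun k ↦ dist_nonneg) ?_ he)
  filter_upwards [hfg] with k hk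
  rwa [dist_comm, Real.dist_eq]

end CsLimitAlongSequence

open CsLimitAlongSequence

/-- **Stub `stub_loopSymmetricLimit_csLimitAlongSequence`** of the skeleton of the crux
`IsingJetsConformal` (stmt-CriticalPhenomena-5560, `n = 0` bridge): assuming the Chelkak–Smirnov
crossing theorem `ChelkakSmirnov2012_fkIsingQuadrilateralCrossing`, along every sequence of
square-lattice discrete quadrilaterals `E k` (meshes `δ k > 0`, `δ k → 0`) whose polygonal
domains, marked at the lattice corners `meshPoint (δ k) (csCorner … j)` as conformal rectangles
`Q k` with Jordan arcs `0, 2` inside the black arcs, converge in Radó's sense (boundary loops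
uniformly, marked points pointwise) to a conformal rectangle `R`, and which eventually contain a
common disc `B(z₀, r)`, lie in `B(z₀, Rad)` and have all four arcs of harmonic measure `≥ t > 0`
from `z₀`, the CS crossing probabilities `csCrossingProb (E k) (d₀ k) (nn k)` converge to
`fkIsingCrossingFunction (crossRatio x)` for every uniformizing datum `(φ, x)` of `R`.
[cite: ChelkakSmirnov2012Ising, Thm. 6.1] -/
theorem stub_loopSymmetricLimit_csLimitAlongSequence : (Literature.Probability.LatticeModels.ChelkakSmirnov2012_fkIsingQuadrilateralCrossing → ∀ (R : Literature.Probability.RandomPlanarGeometry.ConformalRectangle) (Q : ℕ → Literature.Probability.RandomPlanarGeometry.ConformalRectangle) (δ : ℕ → ℝ) (E : ℕ → Finset (Sym2 (Literature.Probability.LatticeModels.Site 2))) (d₀ : ℕ → Literature.Probability.LatticeModels.Site 2 × Fin 4) (nn : ℕ → Fin 4 → ℕ), (∀ k, 0 < δ k) → Filter.Tendsto δ Filter.atTop (nhds 0) → (∀ k, Literature.Probability.LatticeModels.DiscreteRect.IsCSQuadrilateral (E k) (d₀ k) (nn k)) → (∀ k, Literature.Probability.LatticeModels.DiscreteRect.csDomain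 (E k) (d₀ k) (nn k) (δ k) = (Q k).carrier) → (∀ k (j : Fin 4), (Q k).pt j = Literature.Probability.LatticeModels.meshPoint (δ k) (Literature.Probability.LatticeModels.DiscreteRect.csCorner (E k) (d₀ k) (nn k) j)) → (∀ k, (Q k).arc 0 ⊆ Literature.Probability.LatticeModels.DiscreteRect.blackArc (E k) (d₀ k) (nn k) (δ k) 0 ∧ (Q k).arc 2 ⊆ Literature.Probability.LatticeModels.DiscreteRect.blackArc (E k) (d₀ k) (nn k) (δ k) 2) → TendstoUniformly (fun k ↦ (Q k).boundary) R.boundary Filter.atTop → (∀ i : Fin 4, Filter.Tendsto (fun k ↦ (Q k).pt i) Filter.atTop (nhds (R.pt i))) → (∃ (z₀ : ℂ) (r Rad t : ℝ), 0 < r ∧ 0 < Rad ∧ 0 < t ∧ ∀ᶠ k in Filter.atTop, Metric.ball z₀ r ⊆ (Q k).carrier ∧ (Q k).carrier ⊆ Metric.ball z₀ Rad ∧ ∀ i : Fin 4, t ≤ Literature.Analysis.Potential.harmonicMeasure (Q k).carrier z₀ ((Q k).arc i)) → ∀ (φ : Literature.Probability.RandomPlanarGeometry.ConformalEquiv UpperHalfPlane.upperHalfPlaneSet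 R.carrier) (x : Fin 4 → ℝ), R.IsUniformizing φ x → Filter.Tendsto (fun k ↦ Literature.Probability.LatticeModels.DiscreteRect.csCrossingProb (E k) (d₀ k) (nn k)) Filter.atTop (nhds (Literature.Probability.LatticeModels.fkIsingCrossingFunction (Literature.Probability.RandomPlanarGeometry.crossRatio x)))) := by
  intro hCS R Q δ E d₀ nn hpos hδ hq hcar hpt harc hJ hlim hgeom φ x hφ
  obtain ⟨z₀, r, Rad, t, hr, hRad, ht, hev⟩ := hgeom
  -- the Chelkak–Smirnov `ε(δ) = ε(δ, r, Rad, t)`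
  obtain ⟨ε, hε0, hε⟩ := hCS r Rad t hr hRad ht
  -- uniformizing data of the approximating rectangles
  choose ψ y hψ using fun k ↦ MarkedDomain.exists_isUniformizing_holds (Q k)
  -- the moduli converge (Radó) and `p` is continuous
  have hη : Tendsto (fun k ↦ crossRatio (y k)) atTop (𝓝 (crossRatio x)) :=
    ConformalRectangle.tendsto_crossRatio_of_tendstoUniformly hJ hlim ψ y hψ φ x hφ
  have hp : Tendsto (fun k ↦ fkIsingCrossingFunction (crossRatio (y k))) atTop
      (𝓝 (fkIsingCrossingFunction (crossRatio x))) :=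
    (FkIsingCrossingFunctionProps.fkIsingCrossingFunction_continuous.tendsto _).comp hη
  -- `ε (δ k) → 0`
  have hεδ : Tendsto (fun k ↦ ε (δ k)) atTop (𝓝 0) :=
    hε0.comp (tendsto_nhdsWithin_Ioi_of_pos hpos hδ)
  -- the Chelkak–Smirnov bound, eventually
  refine tendsto_of_abs_sub_le hp hεδ ?_
  filter_upwards [hev] with k hk
  obtain ⟨hball, hsub, hhm⟩ := hk
  have h0 : t ≤ harmonicMeasure (Q k).carrier z₀
      (DiscreteRect.blackArc (E k) (d₀ k) (nn k) (δ k) 0) :=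
    (hhm 0).trans (harmonicMeasure_mono (harc k).1 _ _)
  have h2 : t ≤ harmonicMeasure (Q k).carrier z₀
      (DiscreteRect.blackArc (E k) (d₀ k) (nn k) (δ k) 2) :=
    (hhm 2).trans (harmonicMeasure_mono (harc k).2 _ _)
  have hbv : ∀ j : Fin 4, (ψ k).HasBoundaryValue (y k j)
      (meshPoint (δ k) (DiscreteRect.csCorner (E k) (d₀ k) (nn k) j)) := fun j ↦
    hpt k j ▸ (hψ k).2 j
  exact abs_sub_le_of_carrier_eq hε (hpos k) (hq k) (hcar k) hball hsub h0 h2 (ψ k) (y k)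
    (hψ k).1 hbv
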